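import Literature.IUT.LogThetaLattice.BiCores
import HarnessLib

/-!
# [IUTchIII] Thm 1.5 (v): "induce AN isomorphism" — the rigidity of `D^⊩(−)` (companion to `BiCores.lean`)

Mochizuki, *Inter-universal Teichmüller Theory III*, kurims manuscript (May 2020), §1, Thm 1.5 (v)
pp.50–51 [cite: Mochizuki2012, III Thm 1.5 (v) pp.50–51] and *Inter-universal Teichmüller Theory II*
(Dec 2020) Cor 4.10 (v) pp.160–161 (D-0012 claim key, status disputed; typed over the interface
`BiCoricData` of `BiCores.lean`; the one printed clause the interface cannot carry is a NAMED `Prop`,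
everything else is proved from the interface). Answers abc-iut-L6-d3's second-pass audit finding F1 on
`BiCores.lean` v3 (p406839, 2026-08-25T20:35Z; concurred by referee lane O, `ref/REFEREE-PASS-O1.md`):
`BiCores.lean` is landed and append-frozen, so the repair is by NEW declarations here.

* Thm 1.5 (v) p.50 l.−8 (d3-F1): "the poly-isomorphisms of `D^⊢`-prime-strips `^{n,m}D^⊢_△ ⥲ ^{n′,m′}D^⊢_△`
  induced by the full poly-isomorphisms of (i), (ii) induce [cf. [IUTchII], Corollaries 4.5, (ii); 4.10,
  (v)] AN ISOMORPHISM of collections of data `(D^⊩(^{n,m}D^⊢_△), Prime(D^⊩(^{n,m}D^⊢_△)) ⥲ V̲, {^{n,m}ρ_{D^⊩,v}}_v) ⥲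
  (…)`" — SINGULAR; [IUTchII] Cor 4.10 (v) p.160: "The full poly-isomorphism `†D^⊢_△ ⥲ ‡D^⊢_△` of (iv)
  induces [cf. Corollary 4.5, (ii)] an isomorphism of collections of data". `BiCores.lean` typed the
  induced POLY-isomorphism `biCoricRealifiedPolyIso` (disclosed as weaker). TYPED HERE: the rigidity
  "parallel isomorphisms of `D^⊢`-prime-strips induce the same isomorphism of `D^⊩`-data" as the named
  `Prop` `RealifiedRigidAt` (the input [IUTchII] Cor 4.10 (v) supplies; its typer abc-iut-L6-t2 records
  Cor 4.10 (v) as not yet statable, `HodgeArakelov/ThetaGauLinks.lean` docstring — TODO-merge), the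
  printed sentence as the named `Prop` `Thm15vSingleIso` ("the induced poly-isomorphism has exactly the
  one constituent"), `thm15vSingleIso_iff_rigid` (PROVED equivalence), and under it
  `biCoricRealifiedPolyIso_eq_single` / `realifiedTransport_eq_orbit` (PROVED): the transported class of
  `BiCores.realifiedTransport` is then exactly the printed double `ℝ_{>0}`-orbit class.
-/

namespace Literature.IUT.LogThetaLattice

open CategoryTheory
open Literature.IUT.HodgeTheaters

universe u

namespace BiCoricData

variable {S : StripFrame.{u}} (B : BiCoricData S)

/-! ### Thm 1.5 (v): "induce AN isomorphism" — the rigidity of `D^⊩(−)` (d3-F1) -/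

/-- **IUTchIII:Thm1.5(v)** (kurims p.50; input [IUTchII] Cor 4.10 (v) p.160, read on the page) "The full poly-isomorphism `†D^⊢_△ ⥲ ‡D^⊢_△` of (iv) induces [cf.
Corollary 4.5, (ii)] an isomorphism of collections of data `(D^⊩(†D^⊢_△), Prime(D^⊩(†D^⊢_△)) ⥲ V̲, {†ρ_{D^⊩,v}}_{v∈V̲}) ⥲
(D^⊩(‡D^⊢_△), …)`" — SINGULAR: the functorial algorithm `D^⊢ ↦ (D^⊩(D^⊢), Prime ⥲ V̲, {ρ_{D^⊩,v}}_v)` of Cor 4.5 (ii)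
(`realified`) sends PARALLEL isomorphisms of `D^⊢`-prime-strips `X ⥲ Y` to the SAME isomorphism of data. Named
`Prop` on the interface (the law [IUTchII] Cor 4.10 (v) supplies; its typer abc-iut-L6-t2 records Cor 4.10 (v)
as not yet kernel-statable over real `D^⊩(−)` — TODO-merge:abc-iut-L6-t2), stated for the pair `X, Y` it is
used at. [claim: Mochizuki2012, status: disputed] -/
def RealifiedRigidAt (X Y : S.Dv) : Prop :=
  ∀ d d' : X ≅ Y, B.realified.mapIso d = B.realified.mapIso d'

/-- **IUTchIII:Thm1.5(v)** (kurims p.50; [IUTchII] Cor 4.10 (v) p.160) equivalently: the poly-isomorphism of `D^⊩`-data induced by the FULL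
poly-isomorphism `X ⥲ Y` has at most one constituent. [claim: Mochizuki2012, status: disputed] -/
theorem realifiedRigidAt_iff_subsingleton (X Y : S.Dv) :
    B.RealifiedRigidAt X Y ↔ ((PolyIso.full X Y).map B.realified).Subsingleton := by
  constructor
  · rintro h _ ⟨d, -, rfl⟩ _ ⟨d', -, rfl⟩
    exact h d d'
  · intro h d d'
    exact h ⟨d, PolyIso.mem_full d, rfl⟩ ⟨d', PolyIso.mem_full d', rfl⟩

/-- **IUTchIII:Thm1.5(v)** (kurims p.50) the printed first sentence of Thm 1.5 (v) as a named `Prop`: "the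
poly-isomorphisms of `D^⊢`-prime-strips `^{n,m}D^⊢_△ ⥲ ^{n′,m′}D^⊢_△` induced by the full poly-isomorphisms of (i), (ii)
induce [cf. [IUTchII], Corollaries 4.5, (ii); 4.10, (v)] AN ISOMORPHISM of collections of data
`(D^⊩(^{n,m}D^⊢_△), Prime(D^⊩(^{n,m}D^⊢_△)) ⥲ V̲, {^{n,m}ρ_{D^⊩,v}}_v) ⥲ (D^⊩(^{n′,m′}D^⊢_△), …)`" — i.e. the induced
poly-isomorphism `biCoricRealifiedPolyIso` of `BiCores.lean` has EXACTLY ONE constituent (at most one: this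
`Prop`; at least one: `biCoricRealifiedPolyIso_nonempty_iff`). [claim: Mochizuki2012, status: disputed] -/
def Thm15vSingleIso : Prop :=
  ∀ H H' : S.DHT, (B.biCoricRealifiedPolyIso H H').Subsingleton

/-- **IUTchIII:Thm1.5(v)** (kurims p.50) the printed sentence holds iff the [IUTchII] Cor 4.10 (v) rigidity holds
at every pair of `D^⊢`-prime-strips `^{n,m}D^⊢_△`, `^{n′,m′}D^⊢_△`. [claim: Mochizuki2012, status: disputed] -/
theorem thm15vSingleIso_iff_rigid :
    B.Thm15vSingleIso ↔ ∀ H H' : S.DHT, B.RealifiedRigidAt (B.dvDeltaOf H) (B.dvDeltaOf H') := by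
  simp only [Thm15vSingleIso, biCoricRealifiedPolyIso, realifiedRigidAt_iff_subsingleton]

/-- **IUTchIII:Thm1.5(v)** (kurims p.50) the induced poly-isomorphism is nonempty iff the `D^⊢`-prime-strips are
isomorphic (unconditional). [claim: Mochizuki2012, status: disputed] -/
theorem biCoricRealifiedPolyIso_nonempty_iff (H H' : S.DHT) :
    (B.biCoricRealifiedPolyIso H H').Nonempty ↔ Nonempty (B.dvDeltaOf H ≅ B.dvDeltaOf H') := by
  constructor
  · rintro ⟨_, d, -, rfl⟩
    exact ⟨d⟩
  · rintro ⟨d⟩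
    exact ⟨_, d, PolyIso.mem_full d, rfl⟩

/-- **IUTchIII:Thm1.5(v)** (kurims p.50) under the rigidity, "induce AN isomorphism": the induced poly-isomorphism
IS the single isomorphism `D^⊩(d)`, for any constituent `d`. [claim: Mochizuki2012, status: disputed] -/
theorem biCoricRealifiedPolyIso_eq_single {H H' : S.DHT}
    (h : B.RealifiedRigidAt (B.dvDeltaOf H) (B.dvDeltaOf H')) (d : B.dvDeltaOf H ≅ B.dvDeltaOf H') :
    B.biCoricRealifiedPolyIso H H' = PolyIso.single (B.realified.mapIso d) := by
  ext e
  simp only [biCoricRealifiedPolyIso, PolyIso.mem_map, PolyIso.mem_full, true_and, PolyIso.mem_single]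
  constructor
  · rintro ⟨d', rfl⟩
    exact h d' d
  · rintro rfl
    exact ⟨d, rfl⟩

/-- **IUTchIII:Thm1.5(v)** (kurims p.50) THE isomorphism `(D^⊩(^{n,m}D^⊢_△), …) ⥲ (D^⊩(^{n′,m′}D^⊢_△), …)` of Thm 1.5 (v),
under the rigidity and given that the `D^⊢`-prime-strips are isomorphic (they are, along the lattice:
Thm 1.5 (i), (ii)). [claim: Mochizuki2012, status: disputed] -/
noncomputable def biCoricRealifiedIso {H H' : S.DHT} (hne : Nonempty (B.dvDeltaOf H ≅ B.dvDeltaOf H')) :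
    B.realified.obj (B.dvDeltaOf H) ≅ B.realified.obj (B.dvDeltaOf H') :=
  B.realified.mapIso hne.some

/-- **IUTchIII:Thm1.5(v)** (kurims p.50) it does not depend on the constituent used to define it.
[claim: Mochizuki2012, status: disputed] -/
theorem biCoricRealifiedIso_eq {H H' : S.DHT} (h : B.RealifiedRigidAt (B.dvDeltaOf H) (B.dvDeltaOf H'))
    (hne : Nonempty (B.dvDeltaOf H ≅ B.dvDeltaOf H')) (d : B.dvDeltaOf H ≅ B.dvDeltaOf H') :
    B.biCoricRealifiedIso hne = B.realified.mapIso d :=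
  h _ _

/-- **IUTchIII:Thm1.5(v)** (kurims p.51) "compatible, relative to the horizontal arrows …, with the `ℝ_{>0}`-orbits
of the isomorphisms `(^{n,m}C^⊩_△, …) ⥲ (D^⊩(^{n,m}D^⊢_△), …)` … of [IUTchII], Corollary 4.6, (ii)": under the
rigidity the transported class `realifiedTransport` of `BiCores.lean` is exactly the double
`ℝ_{>0}`-orbit class `(orbit at ^{n,m}) ∘ {THE isomorphism} ∘ (orbit at ^{n′,m′})⁻¹`.
[claim: Mochizuki2012, status: disputed] -/
theorem realifiedTransport_eq_orbit {X Y : S.HT}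
    (h : B.RealifiedRigidAt (B.dvDeltaOf (S.htToD.obj X)) (B.dvDeltaOf (S.htToD.obj Y)))
    (d : B.dvDeltaOf (S.htToD.obj X) ≅ B.dvDeltaOf (S.htToD.obj Y)) :
    B.realifiedTransport X Y =
      ((B.realifiedKummer X).comp (PolyIso.single (B.realified.mapIso d))).comp
        (B.realifiedKummer Y).symm := by
  rw [realifiedTransport, B.biCoricRealifiedPolyIso_eq_single h d]

end BiCoricData

end Literature.IUT.LogThetaLattice
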